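import Literature.AnabelianGeometry.AbsoluteAnabelian.AutHolomorphicSpacesPSL2RProofs
import Literature.AnabelianGeometry.AbsoluteAnabelian.AutHolomorphicSpacesPGL2RLemmas
import HarnessLib

/-!
# [AbsTopIII] Prop. 2.2 (ii), second part, DISCHARGED: `Aut^hol ≅ SL₂(ℝ)/{±1}`, `Aut^{RC-hol} ≅ GL₂(ℝ)/ℝˣ`

PROOF-ONLY companion of `AutHolomorphicSpaces` (owner module, abc-iut L4-t2): kernel proof of the
named `Prop` fact `DiscHolAutIsoPSL2R` — S. Mochizuki, *Topics in absolute anabelian geometry III*,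
Prop. 2.2 (ii) p.52: for an Aut-holomorphic disc `X`, isomorphisms of topological groups
`Aut^hol(X) ≅ SL₂(ℝ)/{±1}` and `Aut^{RC-hol}(X) ≅ GL₂(ℝ)/ℝ^×` (compact-open topology on the
automorphism side, quotient topologies on the matrix side).

Route: `X ≅ 𝔻 ≅ ℍ` (the given disc structure and the Cayley transform); `GL₂(ℝ)` acts on `ℍ` by
(anti-)Möbius transformations (Mathlib), giving `θ : GL₂(ℝ) → Aut(X^top)` with kernel the centre
and image the RC-holomorphic automorphisms (the tree's `Aut(𝔻)` classification + Beardon 7.4.1);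
continuity of `θ` from the joint continuity of the action; continuity of the inverse on `Aut^hol`
by properness of `SL₂(ℝ) → ℍ × ℍ` (`AutHolomorphicSpacesPSL2RProofs`), extended to `Aut^{RC-hol}`
by the clopen decomposition into holomorphic and anti-holomorphic parts detected by the continuous
orientation functional of `AutHolomorphicSpacesPGL2RLemmas`.

HONEST FRAMING: our kernel check of a classical statement of a refereed paper; nothing here bears
on [IUTchIII] Cor. 3.12.  Bib key `MochizukiAbsTopIII2015`; locators = kurims manuscript pages.
-/

noncomputable section

namespace Literature.AnabelianGeometry.AbsoluteAnabelian

open _root_.TopologicalSpace _root_.Topology _root_.Set _root_.Metric _root_.Function _root_.Filter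
open scoped _root_.Manifold _root_.ContDiff ComplexConjugate UpperHalfPlane MatrixGroups
open _root_.UpperHalfPlane Literature.Analysis.Complex
open _root_.Complex (discMobius discMobius_self)

section Topology

variable {Y : Type} [TopologicalSpace Y]

/-- The conjugated `GL(2, ℝ)`-action is continuous into the compact-open topology.
[cite: MochizukiAbsTopIII2015, Proposition 2.2 (ii) p.52] -/
theorem continuous_conjSmulGL (κ : Y ≃ₜ ℍ) :
    letI := homeoCompactOpen Y
    Continuous fun g : GL (Fin 2) ℝ => κ.trans ((Homeomorph.smul g).trans κ.symm) := by
  letI := homeoCompactOpen Y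
  refine continuous_induced_rng.2 ?_
  apply ContinuousMap.continuous_of_continuous_uncurry
  show Continuous fun p : GL (Fin 2) ℝ × Y => κ.symm (p.1 • κ p.2)
  exact κ.symm.continuous.comp (continuous_fst.smul (κ.continuous.comp continuous_snd))

/-- Left multiplication is continuous on `Y ≃ₜ Y` (compact-open topology).
[cite: MochizukiAbsTopIII2015, Proposition 2.2 (ii) p.52] -/
theorem continuous_mul_left_homeomorph (r : Y ≃ₜ Y) :
    letI := homeoCompactOpen Y
    Continuous fun ψ : Y ≃ₜ Y => r * ψ := by
  letI := homeoCompactOpen Y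
  refine continuous_induced_rng.2 ?_
  show Continuous fun ψ : Y ≃ₜ Y => (r : C(Y, Y)).comp (ψ : C(Y, Y))
  exact (ContinuousMap.continuous_postcomp _).comp continuous_induced_dom

end Topology

section Main

variable {Y : Type} [TopologicalSpace Y] [ChartedSpace ℂ Y]

/-- Composing an anti-Möbius-picture element with the reflection `θ(J)` gives a biholomorphic one.
[cite: MochizukiAbsTopIII2015, Proposition 2.2 (ii) p.52] -/
theorem mdifferentiable_J_mul (κ : Y ≃ₜ ℍ) {C : unitDiscOpens ≃ₜ ℍ}
    (hC : MDifferentiable 𝓘(ℂ, ℂ) 𝓘(ℂ, ℂ) C) (hCs : MDifferentiable 𝓘(ℂ, ℂ) 𝓘(ℂ, ℂ) C.symm)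
    (hκ : MDifferentiable 𝓘(ℂ, ℂ) 𝓘(ℂ, ℂ) κ) (hκs : MDifferentiable 𝓘(ℂ, ℂ) 𝓘(ℂ, ℂ) κ.symm)
    (hCz : ∀ z : ℍ, ((C.symm z : unitDiscOpens) : ℂ) = ((z : ℂ) - Complex.I) / ((z : ℂ) + Complex.I))
    {ψ : Y ≃ₜ Y} {c a : ℂ} (hc : ‖c‖ = 1) (ha : ‖a‖ < 1)
    (hanti : EqOn (Function.extend Subtype.val (Subtype.val ∘ ((κ.trans C.symm).symm.trans
      (ψ.trans (κ.trans C.symm)))) (fun _ => (0 : ℂ))) (fun z => discRot c a (conj z)) (ball 0 1)) :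
    MDifferentiable 𝓘(ℂ, ℂ) 𝓘(ℂ, ℂ)
        (κ.trans ((Homeomorph.smul UpperHalfPlane.J).trans κ.symm) * ψ) ∧
      MDifferentiable 𝓘(ℂ, ℂ) 𝓘(ℂ, ℂ)
        (κ.trans ((Homeomorph.smul UpperHalfPlane.J).trans κ.symm) * ψ).symm := by
  set e : Y ≃ₜ unitDiscOpens := κ.trans C.symm with he_def
  have he : MDifferentiable 𝓘(ℂ, ℂ) 𝓘(ℂ, ℂ) e := hCs.comp hκ
  have hes : MDifferentiable 𝓘(ℂ, ℂ) 𝓘(ℂ, ℂ) e.symm := hκs.comp hC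
  set ρJ := κ.trans ((Homeomorph.smul UpperHalfPlane.J).trans κ.symm) with hρJ
  have hpicJ : ∀ {z : ℂ} (hz : z ∈ ball (0 : ℂ) 1),
      Function.extend Subtype.val (Subtype.val ∘ (e.symm.trans (ρJ.trans e))) (fun _ => (0 : ℂ)) z =
        conj z := by
    intro z hz
    rw [pic_apply_of_mem e _ hz]
    simp only [he_def, hρJ, Homeomorph.trans_apply, Homeomorph.symm_trans_apply, Homeomorph.symm_symm,
      Homeomorph.apply_symm_apply, Homeomorph.smul_apply]
    rw [cayley_J_smul hCz, C.symm_apply_apply]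
  have hψ' : EqOn (Function.extend Subtype.val (Subtype.val ∘ (e.symm.trans ((ρJ * ψ).trans e)))
      (fun _ => (0 : ℂ))) (discRot (conj c) (conj a)) (ball 0 1) := by
    intro z hz
    rw [pic_mul e ρJ ψ hz, hanti hz, hpicJ ((isDiscAut_discRot hc ha).mapsTo (conj_mem_unitBall hz))]
    exact conj_discRot_conj c a z
  exact mdifferentiable_of_pic_eqOn_discRot e he hes (by rwa [Complex.norm_conj]) (by rwa [Complex.norm_conj]) hψ'

variable [IsManifold 𝓘(ℂ, ℂ) ω Y]

/-- **[AbsTopIII] Prop. 2.2 (ii), `Aut^{RC-hol}(X) ≅ GL₂(ℝ)/ℝˣ` as topological groups**, for any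
Riemann surface `Y` biholomorphic to `ℍ`: the RC-holomorphic self-homeomorphisms form a subgroup
`H` of `Y ≃ₜ Y` (compact-open topology) isomorphic to `GL(2, ℝ) ⧸ center` as a topological group.
[cite: MochizukiAbsTopIII2015, Proposition 2.2 (ii) p.52] -/
theorem exists_continuousMulEquiv_gl (κ : Y ≃ₜ ℍ) (hκ : MDifferentiable 𝓘(ℂ, ℂ) 𝓘(ℂ, ℂ) κ)
    (hκs : MDifferentiable 𝓘(ℂ, ℂ) 𝓘(ℂ, ℂ) κ.symm) :
    letI := homeoCompactOpen Y
    ∃ H : Subgroup (Y ≃ₜ Y),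
      (H : Set (Y ≃ₜ Y)) = {ψ : Y ≃ₜ Y | IsRCHolomorphic (⇑ψ) ∧ IsRCHolomorphic (⇑ψ.symm)} ∧
      Nonempty (H ≃ₜ* (GL (Fin 2) ℝ ⧸ Subgroup.center (GL (Fin 2) ℝ))) := by
  letI := homeoCompactOpen Y
  obtain ⟨C, hC, hCs, hCw, hCz⟩ := exists_cayley
  set e : Y ≃ₜ unitDiscOpens := κ.trans C.symm with he_def
  have he : MDifferentiable 𝓘(ℂ, ℂ) 𝓘(ℂ, ℂ) e := hCs.comp hκ
  have hes : MDifferentiable 𝓘(ℂ, ℂ) 𝓘(ℂ, ℂ) e.symm := hκs.comp hC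
  -- the homomorphism and its range
  let θ : GL (Fin 2) ℝ →* (Y ≃ₜ Y) :=
    { toFun := fun g => κ.trans ((Homeomorph.smul g).trans κ.symm)
      map_one' := conjSmulGL_one κ
      map_mul' := conjSmulGL_mul κ }
  have hθ : ∀ g, θ g = κ.trans ((Homeomorph.smul g).trans κ.symm) := fun g => rfl
  let H : Subgroup (Y ≃ₜ Y) := θ.range
  -- members of `H` = isometry pictures
  have hHiso : ∀ ψ : Y ≃ₜ Y, ψ ∈ H ↔ ∀ z ∈ ball (0 : ℂ) 1, ∀ w ∈ ball (0 : ℂ) 1,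
      discCosh (Function.extend Subtype.val (Subtype.val ∘ (e.symm.trans (ψ.trans e))) (fun _ => (0 : ℂ)) z)
        (Function.extend Subtype.val (Subtype.val ∘ (e.symm.trans (ψ.trans e))) (fun _ => (0 : ℂ)) w) =
      discCosh z w := by
    intro ψ
    constructor
    · rintro ⟨g, rfl⟩
      exact discCosh_pic_conjSmulGL κ hκ hκs hC hCs hCz g
    · intro hiso
      obtain ⟨g, hg⟩ := exists_conjSmulGL_eq κ hκ hκs hC hCs hCz hiso
      exact ⟨g, hg⟩
  -- the biholomorphic subgroup and its `SL(2, ℝ)`-parametrisation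
  let A : Subgroup (Y ≃ₜ Y) :=
    { carrier := {ψ | MDifferentiable 𝓘(ℂ, ℂ) 𝓘(ℂ, ℂ) ψ ∧ MDifferentiable 𝓘(ℂ, ℂ) 𝓘(ℂ, ℂ) ψ.symm}
      mul_mem' := fun {a b} ha hb => ⟨ha.1.comp hb.1, hb.2.comp ha.2⟩
      one_mem' := ⟨mdifferentiable_id, mdifferentiable_id⟩
      inv_mem' := fun {a} ha => ⟨ha.2, ha.1⟩ }
  obtain ⟨F, hF⟩ := exists_continuousMulEquiv_sl κ hκ hκs A fun ψ => Iff.rfl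
  -- kernel and the algebraic isomorphism `GL ⧸ center ≃* H`
  set N := Subgroup.center (GL (Fin 2) ℝ) with hNdef
  have hker : ∀ g, θ.rangeRestrict g = 1 ↔ g ∈ N := by
    intro g
    rw [hNdef, ← conjSmulGL_eq_one_iff κ, ← hθ]
    constructor
    · intro h; exact congrArg Subtype.val h
    · intro h; exact Subtype.ext h
  have hN : N ≤ θ.rangeRestrict.ker := fun g hg => (hker g).2 hg
  let L : GL (Fin 2) ℝ ⧸ N →* H := QuotientGroup.lift N θ.rangeRestrict hN
  have hLmk : ∀ g, L (QuotientGroup.mk g) = θ.rangeRestrict g := fun g => rfl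
  have hLval : ∀ g, ((L (QuotientGroup.mk g) : H) : Y ≃ₜ Y) = κ.trans ((Homeomorph.smul g).trans κ.symm) :=
    fun g => rfl
  have hLinj : Function.Injective L := by
    intro x y hxy
    induction x using QuotientGroup.induction_on with
    | H g =>
      induction y using QuotientGroup.induction_on with
      | H g' =>
        rw [hLmk, hLmk] at hxy
        apply QuotientGroup.eq.2
        rw [← hker, map_mul, map_inv, hxy, inv_mul_cancel]
  have hLsurj : Function.Surjective L := fun a => by
    obtain ⟨g, hg⟩ := θ.rangeRestrict_surjective a
    exact ⟨QuotientGroup.mk g, by rw [hLmk, hg]⟩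
  let E : GL (Fin 2) ℝ ⧸ N ≃* H := MulEquiv.ofBijective L ⟨hLinj, hLsurj⟩
  have hEmk : ∀ g, ((E (QuotientGroup.mk g) : H) : Y ≃ₜ Y) = κ.trans ((Homeomorph.smul g).trans κ.symm) :=
    fun g => rfl
  -- continuity of `L`
  have hθcont : Continuous θ.rangeRestrict := (continuous_conjSmulGL κ).subtype_mk _
  have hLcont : Continuous L := by
    rw [(QuotientGroup.isQuotientMap_mk N).continuous_iff]
    have : (⇑L ∘ QuotientGroup.mk) = ⇑θ.rangeRestrict := funext hLmk
    rw [this]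
    exact hθcont
  -- `ι : SL ⧸ center → GL ⧸ center`
  have hmapGL : Continuous (Matrix.SpecialLinearGroup.mapGL ℝ : SL(2, ℝ) → GL (Fin 2) ℝ) :=
    Matrix.SpecialLinearGroup.continuous_toGL.comp
      ((continuous_algebraMap ℝ ℝ).specialLinearGroup_map)
  have hZ : Subgroup.center SL(2, ℝ) ≤ ((QuotientGroup.mk' N).comp
      (Matrix.SpecialLinearGroup.mapGL ℝ)).ker := by
    intro g hg
    rw [MonoidHom.mem_ker, MonoidHom.comp_apply, QuotientGroup.mk'_apply, QuotientGroup.eq_one_iff,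
      hNdef, ← UpperHalfPlane.forall_smul_eq_self_iff_mem_center]
    intro τ
    rcases mem_center_sl_iff.1 hg with rfl | rfl
    · simp
    · show (-1 : SL(2, ℝ)) • τ = τ
      exact neg_one_sl_smul τ
  let ι : SL(2, ℝ) ⧸ Subgroup.center SL(2, ℝ) →* GL (Fin 2) ℝ ⧸ N :=
    QuotientGroup.lift _ ((QuotientGroup.mk' N).comp (Matrix.SpecialLinearGroup.mapGL ℝ)) hZ
  have hιmk : ∀ g : SL(2, ℝ), ι (QuotientGroup.mk g) =
      QuotientGroup.mk (Matrix.SpecialLinearGroup.mapGL ℝ g) := fun g => rfl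
  have hιcont : Continuous ι := by
    rw [(QuotientGroup.isQuotientMap_mk (Subgroup.center SL(2, ℝ))).continuous_iff]
    have : (⇑ι ∘ QuotientGroup.mk) = QuotientGroup.mk ∘ (Matrix.SpecialLinearGroup.mapGL ℝ) :=
      funext hιmk
    rw [this]
    exact QuotientGroup.continuous_mk.comp hmapGL
  -- the inverse `Ψ = E⁻¹` agrees with `ι ∘ F⁻¹` on biholomorphic elements
  have hkey : ∀ (h : H) (hm : MDifferentiable 𝓘(ℂ, ℂ) 𝓘(ℂ, ℂ) (h : Y ≃ₜ Y) ∧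
      MDifferentiable 𝓘(ℂ, ℂ) 𝓘(ℂ, ℂ) (h : Y ≃ₜ Y).symm),
      E.symm h = ι (F.symm ⟨(h : Y ≃ₜ Y), hm⟩) := by
    intro h hm
    apply E.injective
    rw [E.apply_symm_apply]
    obtain ⟨q, hq⟩ := F.surjective ⟨(h : Y ≃ₜ Y), hm⟩
    rw [← hq, F.symm_apply_apply]
    induction q using QuotientGroup.induction_on with
    | H g =>
      apply Subtype.ext
      rw [hιmk, hEmk, conjSmulGL_mapGL, ← hF g, hq]
  -- the orientation functional splits `H` into two open pieces
  have hδ := continuous_orientation e (Y := Y)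
  have dich : ∀ h : H, _ := fun h : H => orientation_dichotomy e he hes ((hHiso h.1).1 h.2)
  let U₁ : Set H := {h | 0 < (discMobius
      (Function.extend Subtype.val (Subtype.val ∘ (e.symm.trans ((h : Y ≃ₜ Y).trans e))) (fun _ => (0 : ℂ)) 0)
      (Function.extend Subtype.val (Subtype.val ∘ (e.symm.trans ((h : Y ≃ₜ Y).trans e))) (fun _ => (0 : ℂ))
        (Complex.I / 2)) *
      conj (discMobius
        (Function.extend Subtype.val (Subtype.val ∘ (e.symm.trans ((h : Y ≃ₜ Y).trans e))) (fun _ => (0 : ℂ)) 0)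
        (Function.extend Subtype.val (Subtype.val ∘ (e.symm.trans ((h : Y ≃ₜ Y).trans e))) (fun _ => (0 : ℂ))
          (1 / 2)))).im}
  let U₂ : Set H := {h | (discMobius
      (Function.extend Subtype.val (Subtype.val ∘ (e.symm.trans ((h : Y ≃ₜ Y).trans e))) (fun _ => (0 : ℂ)) 0)
      (Function.extend Subtype.val (Subtype.val ∘ (e.symm.trans ((h : Y ≃ₜ Y).trans e))) (fun _ => (0 : ℂ))
        (Complex.I / 2)) *
      conj (discMobius
        (Function.extend Subtype.val (Subtype.val ∘ (e.symm.trans ((h : Y ≃ₜ Y).trans e))) (fun _ => (0 : ℂ)) 0)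
        (Function.extend Subtype.val (Subtype.val ∘ (e.symm.trans ((h : Y ≃ₜ Y).trans e))) (fun _ => (0 : ℂ))
          (1 / 2)))).im < 0}
  have hU₁ : IsOpen U₁ := isOpen_lt continuous_const (hδ.comp continuous_subtype_val)
  have hU₂ : IsOpen U₂ := isOpen_lt (hδ.comp continuous_subtype_val) continuous_const
  have hmemU₁ : ∀ h : H, h ∈ U₁ → MDifferentiable 𝓘(ℂ, ℂ) 𝓘(ℂ, ℂ) (h : Y ≃ₜ Y) ∧
      MDifferentiable 𝓘(ℂ, ℂ) 𝓘(ℂ, ℂ) (h : Y ≃ₜ Y).symm := by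
    intro h hU
    rcases dich h with ⟨hm, -⟩ | ⟨-, hv⟩
    · exact hm
    · exfalso
      have hU' : (0 : ℝ) < _ := hU
      rw [hv] at hU'
      norm_num at hU'
  -- continuity of `E⁻¹` on `U₁`
  have hcontU₁ : ContinuousOn (fun h : H => E.symm h) U₁ := by
    rw [continuousOn_iff_continuous_restrict]
    have hj : Continuous fun u : U₁ => (⟨((u : H) : Y ≃ₜ Y), hmemU₁ u u.2⟩ : A) :=
      (continuous_subtype_val.comp continuous_subtype_val).subtype_mk _
    have : U₁.restrict (fun h : H => E.symm h) = fun u : U₁ => ι (F.symm ⟨((u : H) : Y ≃ₜ Y), hmemU₁ u u.2⟩) := by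
      funext u
      exact hkey u (hmemU₁ u u.2)
    rw [this]
    exact hιcont.comp (F.symm.continuous.comp hj)
  -- the reflection `r = θ(J)` maps `U₂` into `U₁`
  let r : H := ⟨θ UpperHalfPlane.J, ⟨UpperHalfPlane.J, rfl⟩⟩
  have hrJ : ((r⁻¹ : H) : Y ≃ₜ Y) = κ.trans ((Homeomorph.smul UpperHalfPlane.J).trans κ.symm) := by
    show θ (UpperHalfPlane.J)⁻¹ = _
    rw [show (UpperHalfPlane.J)⁻¹ = UpperHalfPlane.J from by
      rw [inv_eq_iff_mul_eq_one, ← sq, UpperHalfPlane.J_sq]]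
    rfl
  have hmaps : MapsTo (fun h : H => r⁻¹ * h) U₂ U₁ := by
    intro h hU
    have hnot : ¬ (MDifferentiable 𝓘(ℂ, ℂ) 𝓘(ℂ, ℂ) (h : Y ≃ₜ Y) ∧
        MDifferentiable 𝓘(ℂ, ℂ) 𝓘(ℂ, ℂ) (h : Y ≃ₜ Y).symm) := by
      rcases dich h with ⟨-, hv⟩ | ⟨hm, -⟩
      · exfalso
        have hU' : _ < (0 : ℝ) := hU
        rw [hv] at hU'
        norm_num at hU'
      · exact hm
    -- `h` has an anti-Möbius picture, so `r⁻¹ h = θ(J) h` is biholomorphic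
    have hbi : MDifferentiable 𝓘(ℂ, ℂ) 𝓘(ℂ, ℂ) ((r⁻¹ * h : H) : Y ≃ₜ Y) ∧
        MDifferentiable 𝓘(ℂ, ℂ) 𝓘(ℂ, ℂ) ((r⁻¹ * h : H) : Y ≃ₜ Y).symm := by
      rcases mdifferentiable_or_conj_of_discCosh_pic e he hes ((hHiso h.1).1 h.2) with hm | ⟨c, a, hc, ha, hanti⟩
      · exact absurd hm hnot
      · have := mdifferentiable_J_mul κ hC hCs hκ hκs hCz hc ha hanti
        rw [Subgroup.coe_mul, hrJ]
        exact this
    rcases dich (r⁻¹ * h) with ⟨-, hv⟩ | ⟨hm, -⟩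
    · show (0 : ℝ) < _
      rw [hv]; norm_num
    · exact absurd hbi hm
  have hmulcont : Continuous fun h : H => r⁻¹ * h := by
    have : Continuous fun h : H => ((r⁻¹ : H) : Y ≃ₜ Y) * (h : Y ≃ₜ Y) :=
      (continuous_mul_left_homeomorph _).comp continuous_subtype_val
    exact this.subtype_mk _
  have hcontU₂ : ContinuousOn (fun h : H => E.symm h) U₂ := by
    have heq : ∀ h : H, E.symm h = E.symm r * E.symm (r⁻¹ * h) := by
      intro h
      rw [← map_mul, mul_inv_cancel_left]
    have h2 : ContinuousOn (fun h : H => E.symm r * E.symm (r⁻¹ * h)) U₂ :=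
      (continuous_const.mul continuous_id).comp_continuousOn (hcontU₁.comp hmulcont.continuousOn hmaps)
    exact h2.congr fun h _ => heq h
  have hΨcont : Continuous fun h : H => E.symm h := by
    rw [continuous_iff_continuousAt]
    intro h
    rcases dich h with ⟨-, hv⟩ | ⟨-, hv⟩
    · have hU : h ∈ U₁ := by show (0 : ℝ) < _; rw [hv]; norm_num
      exact hcontU₁.continuousAt (hU₁.mem_nhds hU)
    · have hU : h ∈ U₂ := by show _ < (0 : ℝ); rw [hv]; norm_num
      exact hcontU₂.continuousAt (hU₂.mem_nhds hU)
  let G : GL (Fin 2) ℝ ⧸ N ≃ₜ* H :=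
    { E with continuous_toFun := hLcont, continuous_invFun := hΨcont }
  refine ⟨H, ?_, ⟨G.symm⟩⟩
  -- `H = Aut^{RC-hol}`
  ext ψ
  simp only [SetLike.mem_coe, mem_setOf_eq]
  constructor
  · intro hψ
    exact ⟨isRCHolomorphic_of_discCosh_pic e he hes ((hHiso ψ).1 hψ),
      isRCHolomorphic_of_discCosh_pic e he hes ((hHiso ψ⁻¹).1 (H.inv_mem hψ))⟩
  · rintro ⟨h1, h2⟩
    exact (hHiso ψ).2 (discCosh_pic_of_isRCHolomorphic e he hes h1 h2)

end Main

/-! ### Prop. 2.2 (ii), second part -/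

/-- **[AbsTopIII] Prop. 2.2 (ii), second part, holds as typed** (`DiscHolAutIsoPSL2R` DISCHARGED):
for an Aut-holomorphic disc `X`, `Aut^hol(X) ≅ SL₂(ℝ)/{±1}` and `Aut^{RC-hol}(X) ≅ GL₂(ℝ)/ℝ^×` as
topological groups. [cite: MochizukiAbsTopIII2015, Proposition 2.2 (ii) p.52] -/
theorem discHolAutIsoPSL2R_holds : DiscHolAutIsoPSL2R := by
  intro X _ _ _ _ hX
  obtain ⟨e, he, hes⟩ := hX.exists_biholomorphic
  -- `⊤ ⊆ X` is biholomorphic to `X`, to the disc and to `ℍ`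
  let tY : (⊤ : Opens X) ≃ₜ X :=
    { toFun := Subtype.val
      invFun := fun x => ⟨x, trivial⟩
      left_inv := fun _ => rfl
      right_inv := fun _ => rfl
      continuous_toFun := continuous_subtype_val
      continuous_invFun := continuous_id.subtype_mk _ }
  have htY : MDifferentiable 𝓘(ℂ, ℂ) 𝓘(ℂ, ℂ) tY := fun y =>
    (mdifferentiableAt_opens_dom_iff (U := (⊤ : Opens X)) (Φ := id)
      (Ψ := fun y : (⊤ : Opens X) => (y : X)) (fun _ => rfl) y).2 mdifferentiableAt_id
  have htYs : MDifferentiable 𝓘(ℂ, ℂ) 𝓘(ℂ, ℂ) tY.symm := fun x =>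
    (mdifferentiableAt_opens_cod_iff (V := (⊤ : Opens X))
      (Ψ := fun x : X => (⟨x, trivial⟩ : (⊤ : Opens X))) x).2 mdifferentiableAt_id
  obtain ⟨C, hC, hCs, -, -⟩ := exists_cayley
  set κ : (⊤ : Opens X) ≃ₜ ℍ := (tY.trans e).trans C with hκdef
  have hκ : MDifferentiable 𝓘(ℂ, ℂ) 𝓘(ℂ, ℂ) κ := hC.comp (he.comp htY)
  have hκs : MDifferentiable 𝓘(ℂ, ℂ) 𝓘(ℂ, ℂ) κ.symm := htYs.comp (hes.comp hCs)
  refine ⟨nonempty_continuousMulEquiv_sl κ hκ hκs (holAut (⊤ : Opens X)) fun ψ => mem_holAut_iff ψ, ?_⟩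
  obtain ⟨H, hH, hne⟩ := exists_continuousMulEquiv_gl κ hκ hκs
  exact ⟨H, by rw [hH]; rfl, hne⟩

end Literature.AnabelianGeometry.AbsoluteAnabelian
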